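import Summits.QuantumFields.YangMills.Theorems.BalabanUVNodesN15KingModelCovariantBlockPureGauge
import Summits.QuantumFields.YangMills.Theorems.BalabanUVNodesN15KingModelCovariantRandomWalk
import HarnessLib

/-!
# BalabanUVNodes ∕ N15 — THE KING-MODEL RUNG (PART Ϥ-h): THE `η`-UNIFORM FLOOR IN A SMALL-FIELD GAUGE — [B9] p.395 l.1–3 «Assuming some regularity of the configuration U it can be easily
# shown that the operator Δ′_a is positive» DECIDED in King's model with the regularity entering as a SMALL FIELD IN SOME GAUGE ((3.37)-type: `‖U(b) − g(b₋)g(b₊)^*‖ ≤ κ` on every bond):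
# a RELATIVE (Peter–Paul) form bound `Re⟨v,A₀(U)v⟩ ≥ ((1−t)κ_V + tm² − (t⁻¹−1)κ²((d+1)c + aD²))Σ‖v_x‖²` against ANY comparison field `V` with floor `κ_V` and `‖U−V‖ ≤ κ` bondwise; at a pure
# gauge `V` (floor `γ_A`, PART Ϥ-g) and King's scaling `c = L²`, `κ = ε₀∕L`: floor `½γ_A − ε₀²((d+1) + a(d+1)²)` — INDEPENDENT OF `L` (η-uniform), unlike the sup-Lipschitz road of PART Ϡ-e
# (which loses `4(d+1)cκ = 4(d+1)Lε₀ → ∞`)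
# (Track A, DAG node N15 = NE2; FAN-OUT v1.1 §N15 s3 «KING-MODEL RUNG … + what the curved case adds»; count-neutral)

HONEST FRAMING.  Count-neutral (cell `pub-ymgap`, seat `pub-ymgap-dag-n15-e` g49; `--supports stmt-QuantumFields-27247 --as helper` = K3ᴬ, KEY MAP v3).  King's comparison model; the
regularity hypothesis is the existence of a gauge in which the link field is within `κ` of the identity on every bond (Bałaban's classes (3.35)–(3.38) p.396–397 are formulated through small
vector potentials `U = e^{iηA}`, `|A|`, `|∇A|` small — here only the zeroth-order smallness `‖U − 1‖ ≤ κ` in a gauge is used, as a HYPOTHESIS; no gauge is constructed from curvature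
bounds in this file).  NOT Bałaban's multi-level `G_k(U)`; NOT (3.42); NOT a node discharge (N15 of record untouched); nothing continuum ∕ ℝ⁴ ∕ OS ∕ Clay.

THE MATHEMATICS.  PETER–PAUL: `‖α+β‖² ≥ (1−t)‖α‖² − (t⁻¹−1)‖β‖²` (`0 < t ≤ 1`).  Bondwise with `α = v_x − V_bv_{x′}`, `β = (V_b − U_b)v_{x′}`, `‖β‖ ≤ κ‖v_{x′}‖`: `Σ bondE_U ≥ (1−t)Σ bondE_V −
(t⁻¹−1)(d+1)κ²Σ‖v_x‖²`.  Blockwise: the transports telescope, `‖U(Γ_j) − V(Γ_j)‖ ≤ depth(j)·κ ≤ Dκ` (products of unitaries), so the transported means differ by `‖m_U − m_V‖² ≤ D²κ²L^{−(d+1)}Σ_j‖v_{x_j}‖²`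
(Cauchy–Schwarz) and `aL^{d+1}Σ_y‖m_U‖² ≥ (1−t)aL^{d+1}Σ_y‖m_V‖² − (t⁻¹−1)aD²κ²Σ‖v_x‖²`.  Adding the mass: ★★★ `Re⟨v,A₀(U)v⟩ ≥ ((1−t)κ_V + tm² − (t⁻¹−1)κ²((d+1)c + aD²))·Σ‖v_x‖²`.
RESULTS: §1 `peterPaul_sq` (real), ★ `norm_add_sq_ge_peterPaul` (normed groups), `norm_mul_sub_mul_le_of_unitary` (Ͱ-d `l2_opNorm_of_mem_unitaryGroup_le`), ★ `norm_treeHol_sub_le` (`≤ depth·κ`), ★ `bondE_ge_relative`, ★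
`norm_treeMean_blockTransport_sub_sq_le`; §2 ★★★ **`re_quadForm_fullOpU_ge_relative`** (any tree contour system of depth `≤ D`, any unitary `U, V` with `‖U_b − V_b‖ ≤ κ`, any floor `κ_V` of
`A₀(V)`, `0 < t ≤ 1`, `c, a ≥ 0`); §3 ★★★ **`re_quadForm_fullOpU_ge_of_near_pureGauge`** (King's scaling `c = L²`, `L ≥ 1`, `a, m² ≥ 0`, `t = ½`: `U` within `κ` of a pure gauge bondwise ⟹ floor
`½γ_A − κ²((d+1)L² + aD²)`), ★★★ **`re_quadForm_fullOpU_ge_uniform_of_small_field`** (comb, `κ = ε₀∕L`: floor `½γ_A − ε₀²((d+1) + a(d+1)²)` for EVERY `L ≥ 1` — η-UNIFORM), ★★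
`posDef_fullOpU_massless_of_small_field` (massless, `ε₀²((d+1) + a(d+1)²) < ½γ_A` ⟹ `≻ 0` with an `L`-free margin), ★★ `l2_opNorm_fullOpU_massless_inv_le_of_small_field`, ★★★
**`king_B9_p395_positivity_decided`** (the three regimes by name: every `U` — tree floor; rough `U` — `Θ(η^d)`; small-field gauge — η-uniform).
PRIOR TREE ART (by name): Ϥ-a (`treeMean`), Ϥ-b (`treeHol`, `treeHol_root∕_of_ne_root∕_mem_unitaryGroup`, `BlockTree.induction`, `kingComb`, `kingComb_depth_le`), Ϥ-c (`blockTransport`, `fib_covQ_mulVec`,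
`sum_norm_blockTransport_sq`, `norm_blockTransport`), Ϥ-d (`fullOpU`, `re_quadForm_fullOpU`, `isHermitian_fullOpU`), Ϥ-e (`treeGap`, engines), Ϥ-f∕Ϥ-g (`king_full_propagator_floor_two_sided`,
`re_quadForm_fullOpU_pureGauge_ge_gamA`, `pureGauge_mem_unitaryGroup`), Ϡ-e (`norm_covDiff_sq_ge_of_near` — the sup-Lipschitz road, for contrast), Ͱ-b (`norm_toEuclideanLin_of_mem_unitaryGroup`), Mathlib
(`Matrix.l2_opNorm_mulVec`, `sq_sum_le_card_mul_sum_sq`, `norm_mul_le`).  Dedup (rg at filing): basename 0 files; needles `peterPaul|re_quadForm_fullOpU_ge_relative|of_small_field|norm_treeHol_sub_le` 0 files in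
`Summits/QuantumFields/YangMills` + `Literature/MathematicalPhysics`.  presearch: «relative form bound small field gauge covariant Laplacian block averaging uniform» corpus+galaxy — the printed
source is [B9] p.395 l.1–3 (claim without proof) with (3.37); no printed constant.  Locators: [Balaban1985BackgroundPropagators] p.395 l.1–3, (3.35)–(3.38) p.396–397, (3.24) p.394; [King1986]
(2.13) p.653, (4.33) p.674; [Dimock2013] App. D Lemma 29.  0 `sorry`, 0 `def`.
-/

noncomputable section
open scoped BigOperators ComplexConjugate ComplexOrder Matrix.Norms.L2Operator
open Finset Matrix WithLp

namespace Summit.QuantumFields.YangMills.BalabanUVNodes.N15KingModelRung.CovariantBlock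

open Literature.MathematicalPhysics.QuantumFieldTheory.Balaban1983to89.B5Prop11Plancherel (Tor fine unitVec)
open Literature.MathematicalPhysics.QuantumFieldTheory.King1986.Torus (site blockEquiv blockEquiv_apply gamA gamA_pos)
open Summit.QuantumFields.YangMills.BalabanUVNodes.N15KingModelRung.Covariant (covLapF kingGaugeAct fib fib_apply sum_norm_fib_sq norm_toEuclideanLin_of_mem_unitaryGroup l2_opNorm_of_mem_unitaryGroup_le)
open Summit.QuantumFields.YangMills.BalabanUVNodes.N15KingModelRung.Curvature (bondE bondE_nonneg toEuclideanLin_mul_apply)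
open Summit.QuantumFields.YangMills.BalabanUVNodes.N15KingModelRung.Landau (eigenvalues_ge_of_coercive' posDef_of_coercive' l2_opNorm_inv_le_of_coercive')

variable {d : ℕ} {L : ℕ} [NeZero L] (T : BlockTree d L) (M : Fin (d + 1) → ℕ) [hM : ∀ μ, NeZero (M μ)]
variable {𝕜 : Type*} [RCLike 𝕜] {n : Type*} [Fintype n] [DecidableEq n]

/-! ## §1 Peter–Paul, unitary contractions, telescoping transports -/

omit hM in
/-- PETER–PAUL, real form: `C ≤ A + B`, `A, B, C ≥ 0`, `0 < t ≤ 1` ⟹ `(1−t)C² − (t⁻¹−1)B² ≤ A²` (`t·[A² − (1−t)(A+B)² + (t⁻¹−1)B²] = (tA − (1−t)B)² ≥ 0`). [folklore] -/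
theorem peterPaul_sq {A B C t : ℝ} (hC : 0 ≤ C) (hCAB : C ≤ A + B) (ht : 0 < t) (ht1 : t ≤ 1) :
    (1 - t) * C ^ 2 - (t⁻¹ - 1) * B ^ 2 ≤ A ^ 2 := by
  have h1 : (1 - t) * C ^ 2 ≤ (1 - t) * (A + B) ^ 2 := mul_le_mul_of_nonneg_left (pow_le_pow_left₀ hC hCAB 2) (by linarith)
  have hkey : t * ((1 - t) * (A + B) ^ 2 - (t⁻¹ - 1) * B ^ 2 - A ^ 2) = -((t * A - (1 - t) * B) ^ 2) := by
    field_simp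
    ring
  have h2 : (1 - t) * (A + B) ^ 2 - (t⁻¹ - 1) * B ^ 2 - A ^ 2 ≤ 0 := by
    nlinarith [hkey, sq_nonneg (t * A - (1 - t) * B), ht]
  linarith

omit hM in
/-- ★ PETER–PAUL in a normed group: `(1−t)‖α‖² − (t⁻¹−1)‖β‖² ≤ ‖α + β‖²` for `0 < t ≤ 1`. [folklore] -/
theorem norm_add_sq_ge_peterPaul {E : Type*} [SeminormedAddCommGroup E] (α β : E) {t : ℝ} (ht : 0 < t) (ht1 : t ≤ 1) :
    (1 - t) * ‖α‖ ^ 2 - (t⁻¹ - 1) * ‖β‖ ^ 2 ≤ ‖α + β‖ ^ 2 := by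
  refine peterPaul_sq (norm_nonneg _) ?_ ht ht1
  have := norm_sub_le (α + β) β
  rwa [add_sub_cancel_right] at this

omit hM in
/-- Products of unitaries are Lipschitz in their factors: `‖AB − A′B′‖ ≤ ‖A − A′‖ + ‖B − B′‖` when `B`, `A′` are unitary. [folklore] -/
theorem norm_mul_sub_mul_le_of_unitary {A A' B B' : Matrix n n 𝕜} (hB : B ∈ Matrix.unitaryGroup n 𝕜) (hA' : A' ∈ Matrix.unitaryGroup n 𝕜) :
    ‖A * B - A' * B'‖ ≤ ‖A - A'‖ + ‖B - B'‖ := by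
  have hsplit : A * B - A' * B' = (A - A') * B + A' * (B - B') := by noncomm_ring
  rw [hsplit]
  calc ‖(A - A') * B + A' * (B - B')‖ ≤ ‖(A - A') * B‖ + ‖A' * (B - B')‖ := norm_add_le _ _
    _ ≤ ‖A - A'‖ * ‖B‖ + ‖A'‖ * ‖B - B'‖ := add_le_add (norm_mul_le _ _) (norm_mul_le _ _)
    _ ≤ ‖A - A'‖ * 1 + 1 * ‖B - B'‖ := add_le_add (mul_le_mul_of_nonneg_left (l2_opNorm_of_mem_unitaryGroup_le hB) (norm_nonneg _))
        (mul_le_mul_of_nonneg_right (l2_opNorm_of_mem_unitaryGroup_le hA') (norm_nonneg _))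
    _ = ‖A - A'‖ + ‖B - B'‖ := by ring

omit hM in
/-- ★ THE TRANSPORTS TELESCOPE: `‖U(Γ_{y,x_j}) − V(Γ_{y,x_j})‖ ≤ depth(j)·κ` when `‖U_b − V_b‖ ≤ κ` on every bond (unitary `U`, `V`). [cite: Balaban1985BackgroundPropagators, (3.19) p.393] -/
theorem norm_treeHol_sub_le {U V : Tor (fine L M) × Fin (d + 1) → Matrix n n 𝕜} (hU : ∀ bd, U bd ∈ Matrix.unitaryGroup n 𝕜) (hV : ∀ bd, V bd ∈ Matrix.unitaryGroup n 𝕜) {κ : ℝ}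
    (hκ : ∀ bd, ‖U bd - V bd‖ ≤ κ) (b : Tor M) : ∀ j, ‖treeHol M T U b j - treeHol M T V b j‖ ≤ T.depth j * κ := by
  refine T.induction (P := fun j => ‖treeHol M T U b j - treeHol M T V b j‖ ≤ T.depth j * κ) ?_ fun j hj ih => ?_
  · rw [treeHol_root, treeHol_root, sub_self, norm_zero, T.depth_root]; simp
  · rw [treeHol_of_ne_root T M U b hj, treeHol_of_ne_root T M V b hj]
    have hd := T.depth_parent j hj
    calc ‖treeHol M T U b (T.parent j) * U (site L M b (T.parent j), T.axis j) - treeHol M T V b (T.parent j) * V (site L M b (T.parent j), T.axis j)‖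
        ≤ ‖treeHol M T U b (T.parent j) - treeHol M T V b (T.parent j)‖ + ‖U (site L M b (T.parent j), T.axis j) - V (site L M b (T.parent j), T.axis j)‖ :=
          norm_mul_sub_mul_le_of_unitary (hU _) (treeHol_mem_unitaryGroup T M hV b _)
      _ ≤ T.depth (T.parent j) * κ + κ := add_le_add ih (hκ _)
      _ = T.depth j * κ := by rw [← hd]; push_cast; ring

omit [NeZero L] hM in
/-- ★ ONE BOND, RELATIVELY: `bondE_U(x,μ) ≥ (1−t)·bondE_V(x,μ) − (t⁻¹−1)κ²‖v_{x+e_μ}‖²` (`α = v_x − V_bv′`, `β = (V_b−U_b)v′`, Peter–Paul).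
[cite: Balaban1985BackgroundPropagators, (3.23) p.394, (3.37) p.397] -/
theorem bondE_ge_relative {U V : Tor (fine L M) × Fin (d + 1) → Matrix n n 𝕜} {κ : ℝ} (hκ : ∀ bd, ‖U bd - V bd‖ ≤ κ) {t : ℝ} (ht : 0 < t) (ht1 : t ≤ 1)
    (v : Tor (fine L M) × n → 𝕜) (x : Tor (fine L M)) (μ : Fin (d + 1)) :
    (1 - t) * bondE (fine L M) V v x μ - (t⁻¹ - 1) * (κ ^ 2 * ‖fib (fine L M) v (x + unitVec (fine L M) μ)‖ ^ 2) ≤ bondE (fine L M) U v x μ := by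
  set p := fib (fine L M) v x
  set q := fib (fine L M) v (x + unitVec (fine L M) μ)
  have hβ : ‖Matrix.toEuclideanLin (V (x, μ)) q - Matrix.toEuclideanLin (U (x, μ)) q‖ ≤ κ * ‖q‖ := by
    rw [← LinearMap.sub_apply, ← map_sub, Matrix.toLpLin_apply]
    calc ‖(toLp 2 ((V (x, μ) - U (x, μ)) *ᵥ ofLp q) : EuclideanSpace 𝕜 n)‖ ≤ ‖V (x, μ) - U (x, μ)‖ * ‖(toLp 2 (ofLp q) : EuclideanSpace 𝕜 n)‖ := Matrix.l2_opNorm_mulVec _ _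
      _ ≤ κ * ‖q‖ := by rw [toLp_ofLp, norm_sub_rev]; exact mul_le_mul_of_nonneg_right (hκ _) (norm_nonneg _)
  have hκ0 : 0 ≤ κ := (norm_nonneg _).trans (hκ ((0 : Tor (fine L M)), 0))
  have hPP := norm_add_sq_ge_peterPaul (p - Matrix.toEuclideanLin (V (x, μ)) q) (Matrix.toEuclideanLin (V (x, μ)) q - Matrix.toEuclideanLin (U (x, μ)) q) ht ht1
  rw [sub_add_sub_cancel] at hPP
  have hβ2 : ‖Matrix.toEuclideanLin (V (x, μ)) q - Matrix.toEuclideanLin (U (x, μ)) q‖ ^ 2 ≤ κ ^ 2 * ‖q‖ ^ 2 := by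
    rw [← mul_pow]; exact pow_le_pow_left₀ (norm_nonneg _) hβ 2
  have ht' : 0 ≤ t⁻¹ - 1 := by rw [sub_nonneg]; exact (one_le_inv₀ ht).mpr ht1
  unfold bondE
  nlinarith [hPP, mul_le_mul_of_nonneg_left hβ2 ht']

omit hM in
/-- ★ THE TRANSPORTED MEANS DIFFER LITTLE: `‖m_U(y) − m_V(y)‖² ≤ D²κ²·L^{−(d+1)}·Σ_j‖v_{x_j}‖²` (`m = treeMean ∘ blockTransport`, depth `≤ D`). [cite: Balaban1985BackgroundPropagators, (3.19) p.393] -/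
theorem norm_treeMean_blockTransport_sub_sq_le {D : ℕ} (hD : ∀ j, T.depth j ≤ D) {U V : Tor (fine L M) × Fin (d + 1) → Matrix n n 𝕜} (hU : ∀ bd, U bd ∈ Matrix.unitaryGroup n 𝕜)
    (hV : ∀ bd, V bd ∈ Matrix.unitaryGroup n 𝕜) {κ : ℝ} (hκ : ∀ bd, ‖U bd - V bd‖ ≤ κ) (v : Tor (fine L M) × n → 𝕜) (y : Tor M) :
    ‖treeMean (𝕜 := 𝕜) (blockTransport T M U v y) - treeMean (𝕜 := 𝕜) (blockTransport T M V v y)‖ ^ 2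
      ≤ (D * κ) ^ 2 * ((L : ℝ) ^ (d + 1))⁻¹ * ∑ j, ‖fib (fine L M) v (site L M y j)‖ ^ 2 := by
  have hκ0 : 0 ≤ κ := (norm_nonneg _).trans (hκ ((0 : Tor (fine L M)), 0))
  have hcardN : Fintype.card (Fin (d + 1) → Fin L) = L ^ (d + 1) := by rw [Fintype.card_fun, Fintype.card_fin, Fintype.card_fin]
  have hcard : (Fintype.card (Fin (d + 1) → Fin L) : 𝕜) = (L : 𝕜) ^ (d + 1) := by rw [hcardN]; push_cast; ring
  have hLpos : (0 : ℝ) < (L : ℝ) ^ (d + 1) := pow_pos (by exact_mod_cast Nat.pos_of_ne_zero (NeZero.ne L)) _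
  -- the difference of the means is the mean of the differences
  have hdiff : treeMean (𝕜 := 𝕜) (blockTransport T M U v y) - treeMean (𝕜 := 𝕜) (blockTransport T M V v y)
      = ((L : 𝕜) ^ (d + 1))⁻¹ • ∑ j, (Matrix.toEuclideanLin (treeHol M T U y j - treeHol M T V y j)) (fib (fine L M) v (site L M y j)) := by
    rw [treeMean, treeMean, hcard, ← smul_sub, ← Finset.sum_sub_distrib]
    congr 1
    refine Finset.sum_congr rfl fun j _ => ?_
    rw [blockTransport, blockTransport, map_sub, LinearMap.sub_apply]
  -- termwise bound
  have hterm : ∀ j, ‖(Matrix.toEuclideanLin (treeHol M T U y j - treeHol M T V y j)) (fib (fine L M) v (site L M y j))‖ ≤ D * κ * ‖fib (fine L M) v (site L M y j)‖ := by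
    intro j
    rw [Matrix.toLpLin_apply]
    calc ‖(toLp 2 ((treeHol M T U y j - treeHol M T V y j) *ᵥ ofLp (fib (fine L M) v (site L M y j))) : EuclideanSpace 𝕜 n)‖
        ≤ ‖treeHol M T U y j - treeHol M T V y j‖ * ‖(toLp 2 (ofLp (fib (fine L M) v (site L M y j))) : EuclideanSpace 𝕜 n)‖ := Matrix.l2_opNorm_mulVec _ _
      _ ≤ (T.depth j * κ) * ‖fib (fine L M) v (site L M y j)‖ := by rw [toLp_ofLp]; exact mul_le_mul_of_nonneg_right (norm_treeHol_sub_le T M hU hV hκ y j) (norm_nonneg _)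
      _ ≤ D * κ * ‖fib (fine L M) v (site L M y j)‖ := by gcongr; exact_mod_cast hD j
  have hsum : ‖∑ j, (Matrix.toEuclideanLin (treeHol M T U y j - treeHol M T V y j)) (fib (fine L M) v (site L M y j))‖ ≤ D * κ * ∑ j, ‖fib (fine L M) v (site L M y j)‖ := by
    rw [Finset.mul_sum]; exact (norm_sum_le _ _).trans (Finset.sum_le_sum fun j _ => hterm j)
  have hCS : (∑ j : Fin (d + 1) → Fin L, ‖fib (fine L M) v (site L M y j)‖) ^ 2 ≤ (L : ℝ) ^ (d + 1) * ∑ j, ‖fib (fine L M) v (site L M y j)‖ ^ 2 := by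
    have := sq_sum_le_card_mul_sum_sq (s := (Finset.univ : Finset (Fin (d + 1) → Fin L))) (f := fun j => ‖fib (fine L M) v (site L M y j)‖)
    rw [Finset.card_univ, hcardN] at this; push_cast at this; exact this
  rw [hdiff, norm_smul, norm_inv, norm_pow, RCLike.norm_natCast]
  set N : ℝ := (L : ℝ) ^ (d + 1) with hN
  set Sn := ‖∑ j, (Matrix.toEuclideanLin (treeHol M T U y j - treeHol M T V y j)) (fib (fine L M) v (site L M y j))‖
  set F := ∑ j, ‖fib (fine L M) v (site L M y j)‖
  set F2 := ∑ j, ‖fib (fine L M) v (site L M y j)‖ ^ 2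
  have hF : 0 ≤ F := Finset.sum_nonneg fun _ _ => norm_nonneg _
  have hDκ : 0 ≤ (D : ℝ) * κ := by positivity
  calc (N⁻¹ * Sn) ^ 2 = N⁻¹ ^ 2 * Sn ^ 2 := mul_pow _ _ _
    _ ≤ N⁻¹ ^ 2 * (D * κ * F) ^ 2 := by gcongr
    _ = N⁻¹ ^ 2 * (D * κ) ^ 2 * F ^ 2 := by ring
    _ ≤ N⁻¹ ^ 2 * (D * κ) ^ 2 * (N * F2) := by gcongr
    _ = (D * κ) ^ 2 * N⁻¹ * F2 := by field_simp

/-! ## §2 The relative form bound -/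

/-- ★★★ **THE RELATIVE FORM BOUND**: unitary `U, V` with `‖U_b − V_b‖ ≤ κ` on every bond, a tree contour system of depth `≤ D`, `c, a ≥ 0`, `0 < t ≤ 1`, and a floor `κ_V·Σ‖v_x‖² ≤ Re⟨v,A₀(V)v⟩`
for all `v` give `((1−t)κ_V + t·m² − (t⁻¹−1)κ²((d+1)c + aD²))·Σ_x‖v_x‖² ≤ Re⟨v,A₀(U)v⟩` — QUADRATIC in `κ` with a coefficient free of the block side when `cκ²` and `aD²κ²` are.
[cite: Balaban1985BackgroundPropagators, p.395 l.1–3, (3.24) p.394, (3.37) p.397; King1986, (2.13) p.653] -/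
theorem re_quadForm_fullOpU_ge_relative {D : ℕ} (hD : ∀ j, T.depth j ≤ D) {c a : ℝ} (hc : 0 ≤ c) (ha : 0 ≤ a) (m2 : ℝ) {U V : Tor (fine L M) × Fin (d + 1) → Matrix n n 𝕜}
    (hU : ∀ bd, U bd ∈ Matrix.unitaryGroup n 𝕜) (hV : ∀ bd, V bd ∈ Matrix.unitaryGroup n 𝕜) {κ : ℝ} (hκ : ∀ bd, ‖U bd - V bd‖ ≤ κ) {t : ℝ} (ht : 0 < t) (ht1 : t ≤ 1) {κV : ℝ}
    (hVfloor : ∀ v : Tor (fine L M) × n → 𝕜, κV * ∑ x, ‖fib (fine L M) v x‖ ^ 2 ≤ RCLike.re (star v ⬝ᵥ (fullOpU T M a c m2 V *ᵥ v))) (v : Tor (fine L M) × n → 𝕜) :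
    ((1 - t) * κV + t * m2 - (t⁻¹ - 1) * κ ^ 2 * (((d : ℝ) + 1) * c + a * (D : ℝ) ^ 2)) * ∑ x, ‖fib (fine L M) v x‖ ^ 2
      ≤ RCLike.re (star v ⬝ᵥ (fullOpU T M a c m2 U *ᵥ v)) := by
  have ht' : 0 ≤ t⁻¹ - 1 := by rw [sub_nonneg]; exact (one_le_inv₀ ht).mpr ht1
  have hLpos : (0 : ℝ) < (L : ℝ) ^ (d + 1) := pow_pos (by exact_mod_cast Nat.pos_of_ne_zero (NeZero.ne L)) _
  set S := ∑ x, ‖fib (fine L M) v x‖ ^ 2 with hS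
  have hS0 : 0 ≤ S := Finset.sum_nonneg fun _ _ => sq_nonneg _
  have hVf := hVfloor v
  rw [re_quadForm_fullOpU T M a c m2 hV v] at hVf
  rw [re_quadForm_fullOpU T M a c m2 hU v]
  -- the bonds
  have hbonds : (1 - t) * ∑ x, ∑ μ, bondE (fine L M) V v x μ - (t⁻¹ - 1) * κ ^ 2 * (((d : ℝ) + 1) * S) ≤ ∑ x, ∑ μ, bondE (fine L M) U v x μ := by
    have hshift : ∑ x, ∑ μ : Fin (d + 1), ‖fib (fine L M) v (x + unitVec (fine L M) μ)‖ ^ 2 = ((d : ℝ) + 1) * S := by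
      rw [Finset.sum_comm]
      have : ∀ μ : Fin (d + 1), ∑ x, ‖fib (fine L M) v (x + unitVec (fine L M) μ)‖ ^ 2 = S := fun μ =>
        Fintype.sum_equiv (Equiv.addRight (unitVec (fine L M) μ)) _ _ fun _ => rfl
      simp_rw [this]
      rw [Finset.sum_const, Finset.card_univ, Fintype.card_fin, nsmul_eq_mul]; push_cast; ring
    have h := Finset.sum_le_sum fun x (_ : x ∈ (univ : Finset (Tor (fine L M)))) => Finset.sum_le_sum fun μ (_ : μ ∈ (univ : Finset (Fin (d + 1)))) => bondE_ge_relative M hκ ht ht1 v x μ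
    simp only [Finset.sum_sub_distrib, ← Finset.mul_sum] at h
    rw [hshift] at h
    linarith
  -- the blocks
  have hblocks : (1 - t) * ((L : ℝ) ^ (d + 1) * ∑ y, ‖fib M (covQ T M V *ᵥ v) y‖ ^ 2) - (t⁻¹ - 1) * κ ^ 2 * ((D : ℝ) ^ 2 * S)
      ≤ (L : ℝ) ^ (d + 1) * ∑ y, ‖fib M (covQ T M U *ᵥ v) y‖ ^ 2 := by
    have hy : ∀ y : Tor M, (1 - t) * ‖fib M (covQ T M V *ᵥ v) y‖ ^ 2 - (t⁻¹ - 1) * ((D * κ) ^ 2 * ((L : ℝ) ^ (d + 1))⁻¹ * ∑ j, ‖fib (fine L M) v (site L M y j)‖ ^ 2)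
        ≤ ‖fib M (covQ T M U *ᵥ v) y‖ ^ 2 := by
      intro y
      rw [fib_covQ_mulVec, fib_covQ_mulVec]
      have hPP := norm_add_sq_ge_peterPaul (treeMean (𝕜 := 𝕜) (blockTransport T M V v y)) (treeMean (𝕜 := 𝕜) (blockTransport T M U v y) - treeMean (𝕜 := 𝕜) (blockTransport T M V v y)) ht ht1
      rw [add_sub_cancel] at hPP
      have hm := norm_treeMean_blockTransport_sub_sq_le T M hD hU hV hκ v y
      nlinarith [hPP, mul_le_mul_of_nonneg_left hm ht']
    have h := Finset.sum_le_sum fun y (_ : y ∈ (univ : Finset (Tor M))) => hy y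
    have hblk : ∑ y : Tor M, ∑ j : Fin (d + 1) → Fin L, ‖fib (fine L M) v (site L M y j)‖ ^ 2 = S := by
      rw [hS, ← (blockEquiv L M).sum_comp, Fintype.sum_prod_type]; rfl
    have hsplit : ∑ y : Tor M, ((1 - t) * ‖fib M (covQ T M V *ᵥ v) y‖ ^ 2 - (t⁻¹ - 1) * ((D * κ) ^ 2 * ((L : ℝ) ^ (d + 1))⁻¹ * ∑ j, ‖fib (fine L M) v (site L M y j)‖ ^ 2))
        = (1 - t) * ∑ y, ‖fib M (covQ T M V *ᵥ v) y‖ ^ 2 - (t⁻¹ - 1) * ((D * κ) ^ 2 * ((L : ℝ) ^ (d + 1))⁻¹ * S) := by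
      rw [Finset.sum_sub_distrib, ← hblk]
      simp only [← Finset.mul_sum]
    rw [hsplit] at h
    have key : (1 - t) * ((L : ℝ) ^ (d + 1) * ∑ y, ‖fib M (covQ T M V *ᵥ v) y‖ ^ 2) - (t⁻¹ - 1) * κ ^ 2 * ((D : ℝ) ^ 2 * S)
        = (L : ℝ) ^ (d + 1) * ((1 - t) * ∑ y, ‖fib M (covQ T M V *ᵥ v) y‖ ^ 2 - (t⁻¹ - 1) * ((D * κ) ^ 2 * ((L : ℝ) ^ (d + 1))⁻¹ * S)) := by
      field_simp
    rw [key]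
    exact mul_le_mul_of_nonneg_left h hLpos.le
  have hblocks' := mul_le_mul_of_nonneg_left hblocks ha
  have hbonds' := mul_le_mul_of_nonneg_left hbonds hc
  nlinarith [hbonds', hblocks', hVf, hS0, ht, ht1]

/-! ## §3 Near a pure gauge: the `η`-uniform floor -/

/-- ★★★ **NEAR A PURE GAUGE** (King's scaling `c = L²`, `L ≥ 1`, `a, m² ≥ 0`, tree contour system of depth `≤ D`): if the unitary link field `U` is within `κ` of a pure gauge on every bond,
`‖U(b) − g(b₋)g(b₊)^*‖ ≤ κ` (i.e. `‖U^{g⁻¹} − 1‖ ≤ κ`: a small field in some gauge), then `(½γ_A − κ²((d+1)L² + aD²))·Σ_x‖v_x‖² ≤ Re⟨v,A₀(U)v⟩` (Peter–Paul with `t = ½` against the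
pure gauge, whose floor is `γ_A`, PART Ϥ-g). [cite: Balaban1985BackgroundPropagators, p.395 l.1–3, (3.37) p.397; King1986, (4.33) p.674; Dimock2013, App. D Lemma 29] -/
theorem re_quadForm_fullOpU_ge_of_near_pureGauge {D : ℕ} (hD : ∀ j, T.depth j ≤ D) (hL : 1 ≤ L) {a m2 : ℝ} (ha : 0 ≤ a) (hm : 0 ≤ m2)
    {U : Tor (fine L M) × Fin (d + 1) → Matrix n n 𝕜} (hU : ∀ bd, U bd ∈ Matrix.unitaryGroup n 𝕜) {g : Tor (fine L M) → Matrix n n 𝕜} (hg : ∀ x, g x ∈ Matrix.unitaryGroup n 𝕜)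
    {κ : ℝ} (hκ : ∀ bd, ‖U bd - kingGaugeAct (fine L M) g (fun _ => (1 : Matrix n n 𝕜)) bd‖ ≤ κ) (v : Tor (fine L M) × n → 𝕜) :
    (gamA a (d + 1) / 2 - κ ^ 2 * (((d : ℝ) + 1) * (L : ℝ) ^ 2 + a * (D : ℝ) ^ 2)) * ∑ x, ‖fib (fine L M) v x‖ ^ 2
      ≤ RCLike.re (star v ⬝ᵥ (fullOpU T M a ((L : ℝ) ^ 2) m2 U *ᵥ v)) := by
  have h := re_quadForm_fullOpU_ge_relative T M hD (c := (L : ℝ) ^ 2) (by positivity) ha m2 hU (pureGauge_mem_unitaryGroup M hg) hκ (t := 1 / 2) (by norm_num) (by norm_num)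
    (re_quadForm_fullOpU_pureGauge_ge_gamA T M hL ha hm hg) v
  have hS : 0 ≤ ∑ x, ‖fib (fine L M) v x‖ ^ 2 := Finset.sum_nonneg fun _ _ => sq_nonneg _
  refine le_trans (mul_le_mul_of_nonneg_right ?_ hS) h
  norm_num
  nlinarith [sq_nonneg κ, hm]

/-- ★★★ **THE `η`-UNIFORM FLOOR IN A SMALL-FIELD GAUGE** (comb contours; King's scaling `c = L² = η⁻²`; `κ = ε₀∕L`, i.e. `‖U − (pure gauge)‖ ≤ ε₀η` on every bond — a vector potential of size
`ε₀` in that gauge): `(½γ_A − ε₀²((d+1) + a(d+1)²))·Σ_x‖v_x‖² ≤ Re⟨v,A₀(U)v⟩` for EVERY `L ≥ 1` — the constant does not see the lattice spacing.  This is [B9] p.395 l.1–3 («assuming some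
regularity of the configuration U … the operator Δ′_a is positive») decided in King's model with the regularity read as (3.37)'s small field; contrast PART Ϥ-f (no regularity: `Θ(η^d)`).
[cite: Balaban1985BackgroundPropagators, p.395 l.1–3, (3.37) p.397; King1986, (2.13) p.653, (4.33) p.674; Dimock2013, App. D Lemma 29] -/
theorem re_quadForm_fullOpU_ge_uniform_of_small_field (hL : 1 ≤ L) {a m2 : ℝ} (ha : 0 ≤ a) (hm : 0 ≤ m2)
    {U : Tor (fine L M) × Fin (d + 1) → Matrix n n 𝕜} (hU : ∀ bd, U bd ∈ Matrix.unitaryGroup n 𝕜) {g : Tor (fine L M) → Matrix n n 𝕜} (hg : ∀ x, g x ∈ Matrix.unitaryGroup n 𝕜)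
    {ε₀ : ℝ} (hκ : ∀ bd, ‖U bd - kingGaugeAct (fine L M) g (fun _ => (1 : Matrix n n 𝕜)) bd‖ ≤ ε₀ / L) (v : Tor (fine L M) × n → 𝕜) :
    (gamA a (d + 1) / 2 - ε₀ ^ 2 * (((d : ℝ) + 1) + a * ((d : ℝ) + 1) ^ 2)) * ∑ x, ‖fib (fine L M) v x‖ ^ 2
      ≤ RCLike.re (star v ⬝ᵥ (fullOpU (kingComb d L) M a ((L : ℝ) ^ 2) m2 U *ᵥ v)) := by
  have h := re_quadForm_fullOpU_ge_of_near_pureGauge (kingComb d L) M kingComb_depth_le hL ha hm hU hg hκ v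
  have hS : 0 ≤ ∑ x, ‖fib (fine L M) v x‖ ^ 2 := Finset.sum_nonneg fun _ _ => sq_nonneg _
  refine le_trans (mul_le_mul_of_nonneg_right ?_ hS) h
  have hL0 : (0 : ℝ) < L := by exact_mod_cast hL
  have hL1 : (1 : ℝ) ≤ L := by exact_mod_cast hL
  -- `(ε₀/L)²·((d+1)L² + a((d+1)(L−1))²) ≤ ε₀²((d+1) + a(d+1)²)`
  have hDL : (((d + 1) * (L - 1) : ℕ) : ℝ) ≤ ((d : ℝ) + 1) * L := by
    have : L - 1 ≤ L := Nat.sub_le L 1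
    calc (((d + 1) * (L - 1) : ℕ) : ℝ) = ((d : ℝ) + 1) * ((L - 1 : ℕ) : ℝ) := by push_cast; ring
      _ ≤ ((d : ℝ) + 1) * L := by gcongr
  have hkey : (ε₀ / L) ^ 2 * (((d : ℝ) + 1) * (L : ℝ) ^ 2 + a * ((((d + 1) * (L - 1) : ℕ) : ℝ)) ^ 2) ≤ ε₀ ^ 2 * (((d : ℝ) + 1) + a * ((d : ℝ) + 1) ^ 2) := by
    have h1 : a * ((((d + 1) * (L - 1) : ℕ) : ℝ)) ^ 2 ≤ a * (((d : ℝ) + 1) * L) ^ 2 := by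
      gcongr
    have hε : 0 ≤ (ε₀ / L) ^ 2 := sq_nonneg _
    calc (ε₀ / L) ^ 2 * (((d : ℝ) + 1) * (L : ℝ) ^ 2 + a * ((((d + 1) * (L - 1) : ℕ) : ℝ)) ^ 2)
        ≤ (ε₀ / L) ^ 2 * (((d : ℝ) + 1) * (L : ℝ) ^ 2 + a * (((d : ℝ) + 1) * L) ^ 2) := by gcongr
      _ = ε₀ ^ 2 * (((d : ℝ) + 1) + a * ((d : ℝ) + 1) ^ 2) := by field_simp
  linarith

/-- ★★ **THE MASSLESS FULL OPERATOR IS POSITIVE DEFINITE, `η`-UNIFORMLY, IN A SMALL-FIELD GAUGE**: `ε₀²((d+1) + a(d+1)²) < ½γ_A` ⟹ `L²(−Δ_U) + aQ(U)^*Q(U) ≻ 0` with the `L`-free margin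
`½γ_A − ε₀²((d+1) + a(d+1)²)`. [cite: Balaban1985BackgroundPropagators, p.395 l.1–3, (3.37) p.397; King1986, (4.33) p.674] -/
theorem posDef_fullOpU_massless_of_small_field (hL : 1 ≤ L) {a : ℝ} (ha : 0 ≤ a)
    {U : Tor (fine L M) × Fin (d + 1) → Matrix n n 𝕜} (hU : ∀ bd, U bd ∈ Matrix.unitaryGroup n 𝕜) {g : Tor (fine L M) → Matrix n n 𝕜} (hg : ∀ x, g x ∈ Matrix.unitaryGroup n 𝕜)
    {ε₀ : ℝ} (hκ : ∀ bd, ‖U bd - kingGaugeAct (fine L M) g (fun _ => (1 : Matrix n n 𝕜)) bd‖ ≤ ε₀ / L) (hsmall : ε₀ ^ 2 * (((d : ℝ) + 1) + a * ((d : ℝ) + 1) ^ 2) < gamA a (d + 1) / 2) :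
    (fullOpU (kingComb d L) M a ((L : ℝ) ^ 2) 0 U).PosDef :=
  posDef_of_coercive' (fine L M) (isHermitian_fullOpU (kingComb d L) M a _ 0 U) (by linarith) (re_quadForm_fullOpU_ge_uniform_of_small_field M hL ha le_rfl hU hg hκ)

/-- ★★ `‖(L²(−Δ_U) + aQ(U)^*Q(U))⁻¹‖ ≤ (½γ_A − ε₀²((d+1) + a(d+1)²))⁻¹` in a small-field gauge — an `η`-UNIFORM bound on the massless full propagator at regular curved fields.
[cite: Balaban1985BackgroundPropagators, p.395 l.1–3, (3.37) p.397, (3.39) p.397; King1986, (2.13) p.653] -/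
theorem l2_opNorm_fullOpU_massless_inv_le_of_small_field (hL : 1 ≤ L) {a : ℝ} (ha : 0 ≤ a)
    {U : Tor (fine L M) × Fin (d + 1) → Matrix n n 𝕜} (hU : ∀ bd, U bd ∈ Matrix.unitaryGroup n 𝕜) {g : Tor (fine L M) → Matrix n n 𝕜} (hg : ∀ x, g x ∈ Matrix.unitaryGroup n 𝕜)
    {ε₀ : ℝ} (hκ : ∀ bd, ‖U bd - kingGaugeAct (fine L M) g (fun _ => (1 : Matrix n n 𝕜)) bd‖ ≤ ε₀ / L) (hsmall : ε₀ ^ 2 * (((d : ℝ) + 1) + a * ((d : ℝ) + 1) ^ 2) < gamA a (d + 1) / 2) :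
    ‖(fullOpU (kingComb d L) M a ((L : ℝ) ^ 2) 0 U)⁻¹‖ ≤ (gamA a (d + 1) / 2 - ε₀ ^ 2 * (((d : ℝ) + 1) + a * ((d : ℝ) + 1) ^ 2))⁻¹ :=
  l2_opNorm_inv_le_of_coercive' (fine L M) (isHermitian_fullOpU (kingComb d L) M a _ 0 U) (by linarith) (re_quadForm_fullOpU_ge_uniform_of_small_field M hL ha le_rfl hU hg hκ)

/-- ★★★ **[B9] p.395 l.1–3 DECIDED IN KING's MODEL — THE THREE REGIMES BY NAME** (comb contours, King's scaling `c = L²`, massless, `a > 0`, `L ≥ 2`, fibre `ℂⁿ` non-trivial):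
(i) EVERY unitary `U`: `min(a, L²∕(L^{d+1}(d+1)(L−1)))·Σ‖v_x‖² ≤ Re⟨v,A₀(U)v⟩` (tree gauge; `≍ η^d`); (ii) ROUGH fields: some unitary `U` has an eigenvalue `≤ 4π²L^{−d}` (the order of (i) is attained);
(iii) REGULAR fields: every `U` within `ε₀∕L` of a pure gauge bondwise satisfies `(½γ_A − ε₀²((d+1) + a(d+1)²))·Σ‖v_x‖² ≤ Re⟨v,A₀(U)v⟩` — `L`-free.
[cite: Balaban1985BackgroundPropagators, p.395 l.1–3, (3.24) p.394, (3.35)–(3.37) p.396–397; King1986, (2.13) p.653, (4.33) p.674; Dimock2013, App. D Lemma 29] -/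
theorem king_B9_p395_positivity_decided {n : Type*} [Fintype n] [DecidableEq n] [Nonempty n] (hL : 2 ≤ L) {a : ℝ} (ha : 0 < a) :
    (∀ U : Tor (fine L M) × Fin (d + 1) → Matrix n n ℂ, (∀ bd, U bd ∈ Matrix.unitaryGroup n ℂ) →
        ∀ v, treeGap a ((L : ℝ) ^ 2) L d ((d + 1) * (L - 1)) * ∑ x, ‖fib (fine L M) v x‖ ^ 2 ≤ RCLike.re (star v ⬝ᵥ (fullOpU (kingComb d L) M a ((L : ℝ) ^ 2) 0 U *ᵥ v)))
      ∧ (∃ U : Tor (fine L M) × Fin (d + 1) → Matrix n n ℂ, (∀ bd, U bd ∈ Matrix.unitaryGroup n ℂ) ∧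
          ∃ i, (isHermitian_fullOpU (kingComb d L) M a ((L : ℝ) ^ 2) 0 U).eigenvalues i ≤ 4 * Real.pi ^ 2 / (L : ℝ) ^ d)
      ∧ (∀ U : Tor (fine L M) × Fin (d + 1) → Matrix n n ℂ, (∀ bd, U bd ∈ Matrix.unitaryGroup n ℂ) →
          ∀ (g : Tor (fine L M) → Matrix n n ℂ), (∀ x, g x ∈ Matrix.unitaryGroup n ℂ) → ∀ ε₀ : ℝ,
            (∀ bd, ‖U bd - kingGaugeAct (fine L M) g (fun _ => (1 : Matrix n n ℂ)) bd‖ ≤ ε₀ / L) →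
              ∀ v, (gamA a (d + 1) / 2 - ε₀ ^ 2 * (((d : ℝ) + 1) + a * ((d : ℝ) + 1) ^ 2)) * ∑ x, ‖fib (fine L M) v x‖ ^ 2
                ≤ RCLike.re (star v ⬝ᵥ (fullOpU (kingComb d L) M a ((L : ℝ) ^ 2) 0 U *ᵥ v))) := by
  refine ⟨fun U hU v => ?_, (king_flat_vs_rough M hL ha).2, fun U hU g hg ε₀ hκ v => re_quadForm_fullOpU_ge_uniform_of_small_field M (by omega) ha.le le_rfl hU hg hκ v⟩
  have h := re_quadForm_fullOpU_kingComb_ge M (c := (L : ℝ) ^ 2) (by positivity) a 0 hU v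
  rwa [zero_add] at h

end Summit.QuantumFields.YangMills.BalabanUVNodes.N15KingModelRung.CovariantBlock

end
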